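import Literature.Probability.Percolation.TwoPairClusterSplit
import Literature.Probability.Percolation.KozmaNitzanPreFKG
import HarnessLib

/-!
# Pair join versus third-source attachment given an isolated terminal, and the two
# four-terminal "isolation order laws" (van den Berg–Häggström–Kahn 2006, Thm. 2.1 at `q = 1`
# with the vertex sets `S = {s, a, c}`, `T = {b}` and `S = {s, a}`, `T = {b, c}`)

Topic `Literature/Probability/Percolation`.  Proofs only: no definitions, no named facts.  Companion of
`TwoPairClusterSplit.lean` (`twoPair_negCorrelation`, `twoPairSplit`: the instance `S = {s,a}`,
`T = {b,c}`) and `PairAttachmentSepRate.lean` (the instance `S = {p₁,p₂}`, `T = {p₃}`).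

Bond percolation with arbitrary edge probabilities `w : Sym2 V → [0,1]` on a finite vertex type `V`
(`μ = prodBernoulli w` on `BondConfig V = Set (Sym2 V)`), four vertices `s, a, b, c`.  Write
`D = {b ↮ s} ∩ {b ↮ a} ∩ {b ↮ c}` ("`b` is isolated from the three other terminals", `= {S ↮ T}` for
`S = {s,a,c}`, `T = {b}`) and `N = {s ↮ b} ∩ {s ↮ c} ∩ {a ↮ b} ∩ {a ↮ c}` (`= {S ↮ T}` for `S = {s,a}`,
`T = {b,c}`).

* `pairJoin_attach_posCorrelation` — **given that `b` is isolated from `{s,a,c}`, the events `{s ↔ a}`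
  and `{c ↔ s} ∪ {c ↔ a}` are positively correlated**:
  `μ(D ∩ {s↔a}) · μ(D ∩ ({c↔s} ∪ {c↔a})) ≤ μ(D ∩ ({s↔a} ∩ ({c↔s} ∪ {c↔a}))) · μ(D)`.
  Both events are increasing in the union of open edge clusters `C_S`, `S = {s,a,c}`, so this is
  [VandenbergHaggstromKahn2005, Thm. 2.1 at `q = 1`] (equivalently Thm. 1.3 with the source vertex
  replaced by the set `S`, Remark 1 after Thm. 1.2) for `f = 1{s↔a}`, `g = 1{c↔S∖{c}}`, obtained from
  the tree's event form `setTwoClusterExchange`.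
* `orderLaw_isolation_lower` — the same inequality on the complementary marginals
  ("`β ≤ x`" / `W·d₁ ≤ n·d₄` in the four-terminal cell dictionary of the near-critical gluing
  programme): `μ(D ∩ {s↮a}) · μ(D ∩ {c↮s} ∩ {c↮a}) ≤ μ(D ∩ {s↮a} ∩ {c↮s} ∩ {c↮a}) · μ(D)`, i.e.
  `P(s↮a | b isolated) ≤ P(s↮a | b and c isolated)`.
* `orderLaw_isolation_upper` — the complementary-marginal form of `twoPair_negCorrelation`
  ("`x ≤ α`" / `n·d₂ ≤ U·d₁`): `μ(N ∩ {s↮a} ∩ {b↮c}) · μ(N) ≤ μ(N ∩ {s↮a}) · μ(N ∩ {b↮c})`, i.e.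
  `P(s↮a | b and c isolated) ≤ P(s↮a | {s,a} ↮ {b,c})`.
* `orderLaws_isolation` — both laws in one display, with the events "all four terminals in distinct
  clusters" and "`b` and `c` isolated" written in one common form (the two descriptions occurring in
  the two laws coincide: private lemmas `allIsolated_eq`, `pairIsolated_eq`).

Status of the statements.  None of the three displays is printed in [VandenbergHaggstromKahn2005]; they
are the instances named above of Theorem 2.1 (p. 9) at `q = 1` — for sets of vertices in place of
`s`, `t` see Remark 1 after Thm. 1.2 (p. 5) — followed by the bookkeeping of the `2 × 2` table of the
two events on the conditioning event.  They were isolated, as the "order laws" `β ≤ x ≤ α` of the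
composite sextic row, in the near-critical gluing programme of
`Summits/CriticalPhenomena/PercolationContinuityZ3` (crux `NoHeavyLowerTail`, stmt-CriticalPhenomena-4575;
census memo prim-sahi-census §96 (W117), where they are checked exactly on all weighted graphs with
at most five vertices); the second is the row SPLIT of `TwoPairClusterSplit.lean` read on marginals.
The random-cluster versions (`q ≥ 1`) hold by the same instances of the tree's
`setClusterEventExchange_rc`; they are not written out here.

## References

* J. van den Berg, O. Häggström, J. Kahn, *Some conditional correlation inequalities for
  percolation and related processes*, Random Structures Algorithms 29 (2006) 417–435
  (arXiv:math/0408176): Thm. 2.1 (p. 9), Thm. 1.3 (p. 6), Thm. 1.4 (p. 7), Remark 1 after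
  Thm. 1.2 (p. 5), definition of `C_s` as the set of EDGES on open paths from `s` (p. 3).
  [VandenbergHaggstromKahn2005]
-/

noncomputable section

open MeasureTheory Set
open Literature.Probability.LatticeModels (prodBernoulli)

namespace Literature.Probability.Percolation

variable {V : Type*}

namespace IsolatedTerminalOrderLaws

/-- `{S ↮ T}` for `S = {s, a, c}`, `T = {b}` is `{s↮b} ∩ {a↮b} ∩ {c↮b}`. [folklore] -/
private theorem setSep_triple_single_eq (s a c b : V) :
    {ω : BondConfig V | ∀ x ∈ ({s, a, c} : Set V), ∀ t ∈ ({b} : Set V),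
        ¬ (openGraph ω).Reachable x t} =
      (openConn s b)ᶜ ∩ (openConn a b)ᶜ ∩ (openConn c b)ᶜ := by
  ext ω
  simp only [mem_insert_iff, mem_singleton_iff, forall_eq_or_imp, forall_eq, mem_setOf_eq,
    mem_inter_iff, mem_compl_iff, openConn]
  exact ⟨fun h => ⟨⟨h.1, h.2.1⟩, h.2.2⟩, fun h => ⟨h.1.1, h.1.2, h.2⟩⟩

/-- The `2 × 2` table of two events `A`, `B` on an event `D` under a finite measure:
`μ(D ∩ A) = μ(D ∩ (A ∩ B)) + μ(D ∩ (A ∩ Bᶜ))`. [folklore] -/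
private theorem real_inter_eq_add [Fintype V] (μ : Measure (BondConfig V)) [IsFiniteMeasure μ]
    (D A B : Set (BondConfig V)) :
    μ.real (D ∩ A) = μ.real (D ∩ (A ∩ B)) + μ.real (D ∩ (A ∩ Bᶜ)) := by
  rw [← measureReal_inter_add_sdiff (s := D ∩ A) (t := B) MeasurableSet.of_discrete, sdiff_eq,
    inter_assoc, inter_assoc]

/-- `μ(D) = μ(D ∩ B) + μ(D ∩ Bᶜ)`. [folklore] -/
private theorem real_eq_add [Fintype V] (μ : Measure (BondConfig V)) [IsFiniteMeasure μ] (D B : Set (BondConfig V)) :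
    μ.real D = μ.real (D ∩ B) + μ.real (D ∩ Bᶜ) := by
  rw [← measureReal_inter_add_sdiff (s := D) (t := B) MeasurableSet.of_discrete, sdiff_eq]

end IsolatedTerminalOrderLaws

open IsolatedTerminalOrderLaws TwoSetExchange in
/-- **Pair join versus third-source attachment, given an isolated terminal** (van den Berg–Häggström–Kahn
2006, Thm. 2.1 at `q = 1` / Thm. 1.3 with the source vertex replaced by the set `S = {s, a, c}` and
`X = {b}`, for `f = 1{s ↔ a}`, `g = 1{c ↔ s or c ↔ a}`, both increasing in `C_S`): with
`D = {s↮b} ∩ {a↮b} ∩ {c↮b}`,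
`μ(D ∩ {s↔a}) · μ(D ∩ ({c↔s} ∪ {c↔a})) ≤ μ(D ∩ ({s↔a} ∩ ({c↔s} ∪ {c↔a}))) · μ(D)`.
[cite: VandenbergHaggstromKahn2005, Thm. 2.1 (p. 9) at q = 1 with S = {s,a,c}, T = {b}; Thm. 1.3 (p. 6) with Remark 1 after Thm. 1.2 (p. 5) — corollary, derived in this file] -/
theorem pairJoin_attach_posCorrelation [Fintype V] (w : Sym2 V → unitInterval) (s a b c : V) :
    (prodBernoulli w).real ((openConn s b)ᶜ ∩ (openConn a b)ᶜ ∩ (openConn c b)ᶜ ∩ openConn s a) *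
      (prodBernoulli w).real
        ((openConn s b)ᶜ ∩ (openConn a b)ᶜ ∩ (openConn c b)ᶜ ∩ (openConn c s ∪ openConn c a)) ≤
    (prodBernoulli w).real
        ((openConn s b)ᶜ ∩ (openConn a b)ᶜ ∩ (openConn c b)ᶜ ∩
          (openConn s a ∩ (openConn c s ∪ openConn c a))) *
      (prodBernoulli w).real ((openConn s b)ᶜ ∩ (openConn a b)ᶜ ∩ (openConn c b)ᶜ) := by
  classical
  have hs : s ∈ ({s, a, c} : Set V) := by simp
  have hc : c ∈ ({s, a, c} : Set V) := by simp
  -- event form of BHK Thm. 2.1 (q = 1): `A₁ = {s ↔ a}`, `A₂ = {c ↔ s} ∪ {c ↔ a}` (type (+)),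
  -- `B₁ = B₂ = Ω`
  have key := setTwoClusterExchange w ({s, a, c} : Set V) ({b} : Set V)
    (A₁ := (openConn s a : Set (BondConfig V)))
    (A₂ := (openConn c s ∪ openConn c a : Set (BondConfig V)))
    (B₁ := (univ : Set (BondConfig V))) (B₂ := (univ : Set (BondConfig V)))
    (typePlus_openConn_of_mem {s, a, c} {b} hs a)
    (fun ω ω' hS hT h => h.elim
      (fun h1 => Or.inl (typePlus_openConn_of_mem {s, a, c} {b} hc s hS hT h1))
      (fun h2 => Or.inr (typePlus_openConn_of_mem {s, a, c} {b} hc a hS hT h2)))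
    (fun _ _ _ _ _ => mem_univ _) (fun _ _ _ _ _ => mem_univ _)
  rw [setSep_triple_single_eq] at key
  simpa only [inter_univ, univ_inter] using key

open IsolatedTerminalOrderLaws in
/-- **Isolation order law, lower** (`β ≤ x`: `P(s↮a | b isolated) ≤ P(s↮a | b and c isolated)`;
the complementary-marginal form of `pairJoin_attach_posCorrelation`): with
`D = {s↮b} ∩ {a↮b} ∩ {c↮b}`,
`μ(D ∩ {s↮a}) · μ(D ∩ ({c↮s} ∩ {c↮a})) ≤ μ(D ∩ ({s↮a} ∩ ({c↮s} ∩ {c↮a}))) · μ(D)`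
(in the cell dictionary `W·d₁ ≤ n·d₄`: `d₄ = μ(b isolated)`, `W = μ(b isolated, s↮a)`,
`d₁ = μ(b, c isolated)`, `n = μ(all four terminals separated)`).
[cite: VandenbergHaggstromKahn2005, Thm. 2.1 (p. 9) at q = 1 with S = {s,a,c}, T = {b} — corollary (2 × 2 bookkeeping), derived in this file] -/
theorem orderLaw_isolation_lower [Fintype V] (w : Sym2 V → unitInterval) (s a b c : V) :
    (prodBernoulli w).real ((openConn s b)ᶜ ∩ (openConn a b)ᶜ ∩ (openConn c b)ᶜ ∩ (openConn s a)ᶜ) *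
      (prodBernoulli w).real
        ((openConn s b)ᶜ ∩ (openConn a b)ᶜ ∩ (openConn c b)ᶜ ∩ ((openConn c s)ᶜ ∩ (openConn c a)ᶜ)) ≤
    (prodBernoulli w).real
        ((openConn s b)ᶜ ∩ (openConn a b)ᶜ ∩ (openConn c b)ᶜ ∩
          ((openConn s a)ᶜ ∩ ((openConn c s)ᶜ ∩ (openConn c a)ᶜ))) *
      (prodBernoulli w).real ((openConn s b)ᶜ ∩ (openConn a b)ᶜ ∩ (openConn c b)ᶜ) := by
  classical
  have key := pairJoin_attach_posCorrelation w s a b c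
  set μ := prodBernoulli w with hμ
  set D : Set (BondConfig V) := (openConn s b)ᶜ ∩ (openConn a b)ᶜ ∩ (openConn c b)ᶜ with hD
  set A : Set (BondConfig V) := openConn s a with hA
  set B : Set (BondConfig V) := openConn c s ∪ openConn c a with hB
  have hBc : ((openConn c s)ᶜ ∩ (openConn c a)ᶜ : Set (BondConfig V)) = Bᶜ := by
    rw [hB, compl_union]
  rw [hBc]
  -- the 2 × 2 table of `(A, B)` on `D`
  set x := μ.real (D ∩ (A ∩ B)) with hx
  set y := μ.real (D ∩ (A ∩ Bᶜ)) with hy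
  set z := μ.real (D ∩ (Aᶜ ∩ B)) with hz
  set u := μ.real (D ∩ (Aᶜ ∩ Bᶜ)) with hu
  have hDA : μ.real (D ∩ A) = x + y := real_inter_eq_add μ D A B
  have hDAc : μ.real (D ∩ Aᶜ) = z + u := real_inter_eq_add μ D Aᶜ B
  have hDB : μ.real (D ∩ B) = x + z := by
    rw [real_inter_eq_add μ D B A, hx, hz, inter_comm B A, inter_comm B Aᶜ]
  have hDBc : μ.real (D ∩ Bᶜ) = y + u := by
    rw [real_inter_eq_add μ D Bᶜ A, hy, hu, inter_comm Bᶜ A, inter_comm Bᶜ Aᶜ]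
  have hDtot : μ.real D = x + y + (z + u) := by
    rw [← hDA, ← hDAc]; exact real_eq_add μ D A
  rw [hDA, hDB, hDtot] at key
  rw [hDAc, hDBc, hDtot]
  have hu0 : 0 ≤ u := measureReal_nonneg
  -- `(x+y)(x+z) ≤ x (x+y+z+u)` is `y z ≤ x u`; the goal `(z+u)(y+u) ≤ u (x+y+z+u)` is the same
  nlinarith [key, hu0]

open IsolatedTerminalOrderLaws in
/-- **Isolation order law, upper** (`x ≤ α`: `P(s↮a | b and c isolated) ≤ P(s↮a | {s,a} ↮ {b,c})`;
the complementary-marginal form of `twoPair_negCorrelation` / `twoPairSplit`, i.e. of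
van den Berg–Häggström–Kahn's Thm. 2.1 at `q = 1` with `S = {s,a}`, `T = {b,c}`): with
`N = {s↮b} ∩ {s↮c} ∩ {a↮b} ∩ {a↮c}`,
`μ(N ∩ ({s↮a} ∩ {b↮c})) · μ(N) ≤ μ(N ∩ {s↮a}) · μ(N ∩ {b↮c})`
(in the cell dictionary `n·d₂ ≤ U·d₁`: `d₂ = μ(N)`, `U = μ(N, s↮a)` = `μ(s, a isolated)`,
`d₁ = μ(N, b↮c)` = `μ(b, c isolated)`, `n = μ(all four terminals separated)`).
[cite: VandenbergHaggstromKahn2005, Thm. 2.1 (p. 9) at q = 1 with S = {s,a}, T = {b,c}; Thm. 1.4 (p. 7) with Remark 1 after Thm. 1.2 (p. 5) — corollary (2 × 2 bookkeeping), derived in this file] -/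
theorem orderLaw_isolation_upper [Fintype V] (w : Sym2 V → unitInterval) (s a b c : V) :
    (prodBernoulli w).real
        ((openConn s b)ᶜ ∩ (openConn s c)ᶜ ∩ (openConn a b)ᶜ ∩ (openConn a c)ᶜ ∩
          ((openConn s a)ᶜ ∩ (openConn b c)ᶜ)) *
      (prodBernoulli w).real
        ((openConn s b)ᶜ ∩ (openConn s c)ᶜ ∩ (openConn a b)ᶜ ∩ (openConn a c)ᶜ) ≤
    (prodBernoulli w).real
        ((openConn s b)ᶜ ∩ (openConn s c)ᶜ ∩ (openConn a b)ᶜ ∩ (openConn a c)ᶜ ∩ (openConn s a)ᶜ) *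
      (prodBernoulli w).real
        ((openConn s b)ᶜ ∩ (openConn s c)ᶜ ∩ (openConn a b)ᶜ ∩ (openConn a c)ᶜ ∩ (openConn b c)ᶜ) := by
  classical
  have key := twoPair_negCorrelation w s a b c
  set μ := prodBernoulli w with hμ
  set N : Set (BondConfig V) :=
    (openConn s b)ᶜ ∩ (openConn s c)ᶜ ∩ (openConn a b)ᶜ ∩ (openConn a c)ᶜ with hN
  set A : Set (BondConfig V) := openConn s a with hA
  set B : Set (BondConfig V) := openConn b c with hB
  -- the 2 × 2 table of `(A, B)` on `N`
  set x := μ.real (N ∩ (A ∩ B)) with hx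
  set y := μ.real (N ∩ (A ∩ Bᶜ)) with hy
  set z := μ.real (N ∩ (Aᶜ ∩ B)) with hz
  set u := μ.real (N ∩ (Aᶜ ∩ Bᶜ)) with hu
  have hNA : μ.real (N ∩ A) = x + y := real_inter_eq_add μ N A B
  have hNAc : μ.real (N ∩ Aᶜ) = z + u := real_inter_eq_add μ N Aᶜ B
  have hNB : μ.real (N ∩ B) = x + z := by
    rw [real_inter_eq_add μ N B A, hx, hz, inter_comm B A, inter_comm B Aᶜ]
  have hNBc : μ.real (N ∩ Bᶜ) = y + u := by
    rw [real_inter_eq_add μ N Bᶜ A, hy, hu, inter_comm Bᶜ A, inter_comm Bᶜ Aᶜ]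
  have hNtot : μ.real N = x + y + (z + u) := by
    rw [← hNA, ← hNAc]; exact real_eq_add μ N A
  rw [hNtot, hNA, hNB] at key
  rw [hNAc, hNBc, hNtot]
  have hu0 : 0 ≤ u := measureReal_nonneg
  -- `(x+y+z+u) x ≤ (x+y)(x+z)` is `x u ≤ y z`; the goal `u (x+y+z+u) ≤ (z+u)(y+u)` is the same
  nlinarith [key, hu0]

namespace IsolatedTerminalOrderLaws

/-- The event "all four terminals lie in distinct open clusters" as it occurs in the two order laws:
`D ∩ ({s↮a} ∩ ({c↮s} ∩ {c↮a})) = N ∩ ({s↮a} ∩ {b↮c})`. [folklore] -/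
private theorem allIsolated_eq (s a b c : V) :
    ((openConn s b)ᶜ ∩ (openConn a b)ᶜ ∩ (openConn c b)ᶜ ∩
        ((openConn s a)ᶜ ∩ ((openConn c s)ᶜ ∩ (openConn c a)ᶜ)) : Set (BondConfig V)) =
      (openConn s b)ᶜ ∩ (openConn s c)ᶜ ∩ (openConn a b)ᶜ ∩ (openConn a c)ᶜ ∩
        ((openConn s a)ᶜ ∩ (openConn b c)ᶜ) := by
  rw [KNPreFKG.openConn_symm c b, KNPreFKG.openConn_symm c s, KNPreFKG.openConn_symm c a]
  ext ω
  simp only [mem_inter_iff, mem_compl_iff]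
  tauto

/-- The event "`b` and `c` are isolated from the other terminals" as it occurs in the two order laws:
`D ∩ ({c↮s} ∩ {c↮a}) = N ∩ {b↮c}`. [folklore] -/
private theorem pairIsolated_eq (s a b c : V) :
    ((openConn s b)ᶜ ∩ (openConn a b)ᶜ ∩ (openConn c b)ᶜ ∩ ((openConn c s)ᶜ ∩ (openConn c a)ᶜ) :
        Set (BondConfig V)) =
      (openConn s b)ᶜ ∩ (openConn s c)ᶜ ∩ (openConn a b)ᶜ ∩ (openConn a c)ᶜ ∩ (openConn b c)ᶜ := by
  rw [KNPreFKG.openConn_symm c b, KNPreFKG.openConn_symm c s, KNPreFKG.openConn_symm c a]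
  ext ω
  simp only [mem_inter_iff, mem_compl_iff]
  tauto

end IsolatedTerminalOrderLaws

/-- **The sandwich `β ≤ x ≤ α` in one display**: with `n = μ(all four terminals separated)`,
`d₁ = μ(b, c isolated)`, `d₄ = μ(b isolated)`, `W = μ(b isolated, s↮a)`, `d₂ = μ({s,a} ↮ {b,c})`,
`U = μ({s,a} ↮ {b,c}, s↮a)`:  `W·d₁ ≤ n·d₄` and `n·d₂ ≤ U·d₁`, the events `n`, `d₁` being written as
in `orderLaw_isolation_upper`.
[cite: VandenbergHaggstromKahn2005, Thm. 2.1 (p. 9) at q = 1 (instances S = {s,a,c}, T = {b} and S = {s,a}, T = {b,c}) — corollary, derived in this file] -/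
theorem orderLaws_isolation [Fintype V] (w : Sym2 V → unitInterval) (s a b c : V) :
    (prodBernoulli w).real ((openConn s b)ᶜ ∩ (openConn a b)ᶜ ∩ (openConn c b)ᶜ ∩ (openConn s a)ᶜ) *
        (prodBernoulli w).real
          ((openConn s b)ᶜ ∩ (openConn s c)ᶜ ∩ (openConn a b)ᶜ ∩ (openConn a c)ᶜ ∩ (openConn b c)ᶜ) ≤
      (prodBernoulli w).real
          ((openConn s b)ᶜ ∩ (openConn s c)ᶜ ∩ (openConn a b)ᶜ ∩ (openConn a c)ᶜ ∩
            ((openConn s a)ᶜ ∩ (openConn b c)ᶜ)) *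
        (prodBernoulli w).real ((openConn s b)ᶜ ∩ (openConn a b)ᶜ ∩ (openConn c b)ᶜ) ∧
    (prodBernoulli w).real
        ((openConn s b)ᶜ ∩ (openConn s c)ᶜ ∩ (openConn a b)ᶜ ∩ (openConn a c)ᶜ ∩
          ((openConn s a)ᶜ ∩ (openConn b c)ᶜ)) *
        (prodBernoulli w).real
          ((openConn s b)ᶜ ∩ (openConn s c)ᶜ ∩ (openConn a b)ᶜ ∩ (openConn a c)ᶜ) ≤
      (prodBernoulli w).real
          ((openConn s b)ᶜ ∩ (openConn s c)ᶜ ∩ (openConn a b)ᶜ ∩ (openConn a c)ᶜ ∩ (openConn s a)ᶜ) *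
        (prodBernoulli w).real
          ((openConn s b)ᶜ ∩ (openConn s c)ᶜ ∩ (openConn a b)ᶜ ∩ (openConn a c)ᶜ ∩ (openConn b c)ᶜ) := by
  refine ⟨?_, orderLaw_isolation_upper w s a b c⟩
  have h := orderLaw_isolation_lower w s a b c
  rw [IsolatedTerminalOrderLaws.allIsolated_eq, IsolatedTerminalOrderLaws.pairIsolated_eq] at h
  exact h

end Literature.Probability.Percolation

end
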